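import Literature.Analysis.FluidPDE.NSCoriolisLaplacian
import Literature.Analysis.FluidPDE.TorusClassicalH1Balance
import HarnessLib

/-!
# The enstrophy equation of the rotating Navier–Stokes system is that of Navier–Stokes

Analysis/FluidPDE proof file (theorems only; no definitions, no named facts), sequel of
`NSCoriolisLaplacian.lean` and `TorusClassicalH1Balance.lean`, supporting the named fact
`Literature.Analysis.FluidPDE.bmn1999_rotating_ns_global_regularity` (Babin–Mahalov–Nicolaenko,
Indiana Univ. Math. J. 48 (1999), Thm. 1.1).

For a `ℤ³`-periodic classical solution of the Navier–Stokes–Coriolis system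
`∂ₜu + (u·∇)u + Ω e₃ × u = νΔu − ∇p + f`, `div u = 0` on `ℝ³ × [a, b]`, read on the torus
(`IsClassicalNSCoriolisSolutionOn … (lift ∘ f) (lift ∘ u) (lift ∘ p)`), the squared gradient norm
obeys **the same enstrophy equation as without rotation**,

`d/dt ½‖∇u(t)‖²_{L²(𝕋³)} = −ν ‖Δu(t)‖²_{L²(𝕋³)} + ∫_{𝕋³} ⟪(u·∇)u(t) − f(t), Δu(t)⟫`

(`IsClassicalNSCoriolisSolutionOn.hasDerivWithinAt_half_torus_gradNormSq`): the rotating system is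
the Navier–Stokes system forced by `f − Ω e₃ × u` (`IsClassicalNSCoriolisSolutionOn.to_torus`), to
which the enstrophy equation of `TorusClassicalH1Balance` applies (FMRT 2001, App. II.A (A.55)),
and the Coriolis forcing pairs to zero with `Δu` (`Torus.integral_inner_coriolisForce_laplacian`,
BMN 1999 p. 1140: "`PJP` is skew-symmetric and commutes with `A^α`"). This is why all `H¹`
(`α = 1`) estimates of BMN 1999, §5 — (5.32), (5.41)–(5.48), Thm. 5.1 — are uniform in `Ω`.

## Mathlib / tree search

Tree (reused): `IsClassicalNSCoriolisSolutionOn.to_torus` (`NSCoriolisTorus`),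
`Torus.integral_inner_coriolisForce_laplacian` (`NSCoriolisLaplacian`),
`Torus.IsClassicalNSSolutionOn.hasDerivWithinAt_half_gradNormSq` (`TorusClassicalH1Balance`),
torus smoothness API (`TorusCalculusProofs`). Mathlib: no rotating-fluid notions.

## References

* A. Babin, A. Mahalov, B. Nicolaenko, *Global regularity of 3D rotating Navier–Stokes equations
  for resonant domains*, Indiana Univ. Math. J. 48 (1999) 1133–1176, §2 p. 1140 and §5.
  [BabinMahalovNicolaenko1999]
* C. Foias, O. Manley, R. Rosa, R. Temam, *Navier–Stokes Equations and Turbulence*, CUP 2001,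
  App. II.A, (A.55). [FoiasManleyRosaTemam2001]
-/

noncomputable section

open MeasureTheory Set Function
open scoped ContDiff Laplacian InnerProductSpace RealInnerProductSpace

namespace Literature.Analysis.FluidPDE

namespace IsClassicalNSCoriolisSolutionOn

variable {a b ν Ω : ℝ} {f u : ℝ → UnitAddTorus (Fin 3) → EuclideanSpace ℝ (Fin 3)}
  {p : ℝ → UnitAddTorus (Fin 3) → ℝ}

/-- **The enstrophy equation of the rotating system** (no `Ω`): for a periodic classical solution
of the Navier–Stokes–Coriolis system on `ℝ³ × [a, b]`, `a < b`, and every `t ∈ [a, b]`,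
`d/dt ½‖∇u(t)‖₂² = −ν (∫ ‖Δu(t)‖²) + ∫ ⟪(u·∇)u(t) − f(t), Δu(t)⟫` within `[a, b]` — the enstrophy
equation (A.55) of Foias–Manley–Rosa–Temam 2001 for the Navier–Stokes system forced by
`f − Ω e₃ × u` (`TorusClassicalH1Balance`), the Coriolis forcing pairing to zero with `Δu`
(`Torus.integral_inner_coriolisForce_laplacian`; BMN 1999, p. 1140).
[cite: BabinMahalovNicolaenko1999, §2 p. 1140 with §5 (5.41)–(5.48)] -/
theorem hasDerivWithinAt_half_torus_gradNormSq
    (h : IsClassicalNSCoriolisSolutionOn (Icc a b) ν Ω (fun t => FunctionSpaces.Torus.lift (f t))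
      (fun t => FunctionSpaces.Torus.lift (u t)) (fun t => FunctionSpaces.Torus.lift (p t)))
    (hab : a < b) {t : ℝ} (ht : t ∈ Icc a b) :
    HasDerivWithinAt (fun s => 2⁻¹ * FunctionSpaces.Torus.gradNormSq (u s))
      (-ν * (∫ x, ‖FunctionSpaces.Torus.laplacian (u t) x‖ ^ 2) +
        ∫ x, ⟪FunctionSpaces.Torus.convect (u t) (u t) x - f t x,
          FunctionSpaces.Torus.laplacian (u t) x⟫) (Icc a b) t := by
  have hT := h.to_torus
  have h1 := hT.hasDerivWithinAt_half_gradNormSq hab ht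
  refine h1.congr_deriv ?_
  congr 1
  -- `∫ ⟪(u·∇)u − (f − Ω e₃ × u), Δu⟫ = ∫ ⟪(u·∇)u − f, Δu⟫ + ∫ ⟪Ω e₃ × u, Δu⟫`, the last being `0`
  have hut : FunctionSpaces.Torus.IsSmooth (u t) := hT.smooth_velocity.isSmooth_slice ht
  have hΔ : FunctionSpaces.Torus.IsSmooth (FunctionSpaces.Torus.laplacian (u t)) := hut.laplacian
  have hC : FunctionSpaces.Torus.IsSmooth (FunctionSpaces.Torus.convect (u t) (u t)) :=
    hut.convect hut
  have hcor : FunctionSpaces.Torus.IsSmooth (fun x => coriolisForce Ω (u t x)) := by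
    have : FunctionSpaces.Torus.IsSmooth ((Ω • crossCLM e₃) ∘ u t) := hut.comp_clm (Ω • crossCLM e₃)
    simpa only [Function.comp_def, ← coriolisForce_eq_smul_crossCLM] using this
  -- the force slice is smooth, being determined by the momentum equation
  have hforce : FunctionSpaces.Torus.IsSmooth (fun x => f t x - coriolisForce Ω (u t x)) := by
    have hA : FunctionSpaces.Torus.IsSmooth (FunctionSpaces.Torus.timeDerivWithin (Icc a b) u t) :=
      hT.smooth_velocity.isSmooth_timeDerivWithin (uniqueDiffOn_Icc hab) ht
    have hpt : FunctionSpaces.Torus.IsSmooth (p t) := hT.smooth_pressure.isSmooth_slice ht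
    have hfun : (fun x => f t x - coriolisForce Ω (u t x)) = fun x =>
        FunctionSpaces.Torus.timeDerivWithin (Icc a b) u t x +
          FunctionSpaces.Torus.convect (u t) (u t) x - ν • FunctionSpaces.Torus.laplacian (u t) x +
          FunctionSpaces.Torus.gradient (p t) x := by
      funext x
      rw [hT.momentum t ht x]
      abel
    rw [hfun]
    exact ((hA.add hC).sub (hΔ.smul ν)).add hpt.gradient
  have hf : FunctionSpaces.Torus.IsSmooth (fun x => f t x) := by
    have hfun : (fun x => f t x) = fun x => (f t x - coriolisForce Ω (u t x)) + coriolisForce Ω (u t x) := by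
      funext x
      abel
    rw [hfun]
    exact hforce.add hcor
  have i1 : Integrable (fun x => ⟪FunctionSpaces.Torus.convect (u t) (u t) x - f t x,
      FunctionSpaces.Torus.laplacian (u t) x⟫) volume := ((hC.sub hf).inner hΔ).integrable
  have i2 : Integrable (fun x => ⟪coriolisForce Ω (u t x),
      FunctionSpaces.Torus.laplacian (u t) x⟫) volume := (hcor.inner hΔ).integrable
  have hsplit : (fun x => ⟪FunctionSpaces.Torus.convect (u t) (u t) x -
        (f t x - coriolisForce Ω (u t x)), FunctionSpaces.Torus.laplacian (u t) x⟫) =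
      fun x => ⟪FunctionSpaces.Torus.convect (u t) (u t) x - f t x,
          FunctionSpaces.Torus.laplacian (u t) x⟫ +
        ⟪coriolisForce Ω (u t x), FunctionSpaces.Torus.laplacian (u t) x⟫ := by
    funext x
    rw [← inner_add_left]
    congr 1
    abel
  rw [hsplit, integral_add i1 i2, Torus.integral_inner_coriolisForce_laplacian Ω hut, add_zero]

end IsClassicalNSCoriolisSolutionOn

end Literature.Analysis.FluidPDE

end
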